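/-
Copyright (c) 2026 the pub-hodgecm-mathlib formalisation cell (harness21).  Prover seat hodgecm-mathlib-K2E4-p11 (g6), Track B ∕ K2-LIT, h413 =
`stmt-HodgeConjecture-24833`, line `K2_E1_TraceFormulaBeta`, campaign «5Res (c) MS-2(χ,τ)» ∕ R8₂ road T′, T1-χ (dealer K2E1-plan (g7) deal (141) 2026-09-04T11:41:07Z):
the (χ,τ)-twin of ★ T1 `K2E1ScatteringBoundMaassSelbergU2` — the continued intertwining operator `M(z, χ)` of `U(1,1)_{L∕L⁺}` is BOUNDED on `½ < Re z ≤ σ₀`, `|Im z| ≥ 1`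
(self-dual `χ = χʷ`), and `y`-FREE BOUNDED hence POLE-FREE on `{½ < Re z}` (off-dual `χ ≠ χʷ`), from the Maass–Selberg relation ALONE — pure real algebra, ζ-free.
-/
import Summits.HodgeConjecture.HodgeConjecture.Theorems.K2E1ChiMaassSelbergContinuedModelsCMTwo   -- ★ p859688 F2b (K2E1-p15): `poleControl_continued_chi_cm_two_of_family_selfDual_on` ((a2)_χ), `normSq_le_of_family_offDual_on`; brings ★ F2 p859658 `…_of_truncatedFamily_on`
import Summits.HodgeConjecture.HodgeConjecture.Theorems.K2E1ScatteringBoundMaassSelbergU2        -- ★ T1 p859417 (K2E1-p13): `le_add_sqrt_of_sq_le` (`s² ≤ A + B s ⇒ s ≤ B + √A`)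
import Summits.HodgeConjecture.HodgeConjecture.Theorems.K2E1BLRemovablePolesU                   -- ★ (L4) (K2E4-p10): `MeromorphicNFAt.analyticAt_of_eventually_norm_le`, `exists_analyticAt_eventuallyEq_…`, `meromorphicAt_and_meromorphicOrderAt_nonneg_…`
import HarnessLib

/-!
# R8₂ ROAD T′, T1-χ — `K2E1ChiScatteringBoundMaassSelbergU2`: `‖M(z, χ)φ‖ ≤ B·‖φ‖` on `½ < Re z ≤ σ₀`, `|Im z| ≥ 1` (self-dual χ), and `‖M(z, χ)φ‖ ≤ T^{2Re z − 1}·‖φ‖` with NO POLE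
# on `{½ < Re z}` (off-dual χ), from the `(χ, τ)` Maass–Selberg relation — pure real algebra, ζ-free

Track B ∕ K2-LIT, crux h413 = `stmt-HodgeConjecture-24833`, route of record `HCCMUnconditional`; cell `hodgecm-mathlib`, squad K2, ENGINE E1, campaign «5Res» (c)∕(f); dealer K2E1-plan
(g7) deal (141).  THEOREMS ONLY (no `def`, no `instance`, no notation, no named-fact hypothesis, no `sorry`; default heartbeats); lane `--kind proof --supports stmt-HodgeConjecture-24833
--as helper` (count-neutral).  Closes no socket.

THE MATHEMATICS ([MoeglinWaldspurger1995, IV.1.11, IV.2.3, IV.3.12 (a)]; [Langlands1976, §7]; [Iwaniec2002, §6.3, §7 p. 103]).  In the bracket currency of ★ row 14 FILE 2 (`a` the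
`⟨φ, φ⟩`-bracket, `b(z)` the `⟨M(z)φ, M(z)φ⟩`-bracket, `x = Re z − ½`, `y = Im z`, `T ≥ 1` the truncation level) the `(χ, τ)` Maass–Selberg relation at `z′ = z` gives, for SELF-DUAL
`χ = χʷ`, the inequality `b ≤ a·T^{4x} + 2x·√a·√b·T^{2x}∕|y|`, whence by the real algebra `s² ≤ A + B·s ⇒ s ≤ B + √A` (★ T1 `le_add_sqrt_of_sq_le`) and `|y| ≥ 1`, `x ≤ σ₀ − ½`:
**`√b(z) ≤ B(σ₀, T)·√a`** — i.e. `‖M(z, χ)φ‖ ≤ B·‖φ‖` with `B` INDEPENDENT of `φ` and of `y` (§2; the same bound read off the box conclusion (a2)_χ of ★ F2∕F2b in §3, which is how it is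
PAID today on any domain `D₁` the pole-exclusion files reach).  For OFF-DUAL `χ ≠ χʷ` the cross brackets vanish and the two-term relation gives the `y`-FREE bound `b(z) ≤ T^{4x}·a` (★ F2b
`normSq_le_of_family_offDual_on`), i.e. **`‖M(z, χ)φ‖ ≤ T^{2Re z − 1}·‖φ‖` at EVERY point of the continued domain, up to the real axis** (§4); since `z ↦ T^{2Re z−1}` is locally bounded,
the continued family is bounded on a punctured neighbourhood of every point `z₁` that the domain surrounds (`∀ᶠ z in 𝓝[≠] z₁, z ∈ D₁`, e.g. `D₁ = D⁺ ∖ P` with `P` discrete), so by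
Riemann (★ (L4) bricks) it has NON-NEGATIVE meromorphic order ∕ an analytic extension ∕ is analytic in normal form at `z₁`: **the off-dual continued family has NO POLE in `{½ < Re z}`**
(§5) — the piece that makes the infinitely many off-dual families harmless downstream ([MW] IV.1.11: singularities in the positive chamber come from self-associate data only).

* §1 real algebra: `sqrt_le_mul_sqrt_of_box` ((a2)-shape ⟹ `√b ≤ (x₂T^{2x₂}∕η + √(x₂²T^{4x₂}∕η² + T^{4x₂}))·√a`), `norm_le_of_normSq_le` (`κm‖u‖² ≤ T^{4x}·κm‖φ‖² ⟹ ‖u‖ ≤ T^{2x}‖φ‖`).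
* §2 SELF-DUAL, hypothesis-first on the MS-χ inequality: **`sqrt_bracket_le_of_maassSelberg_ineq`** (rank parameter `ρ₀`; explicit `B = (2(σ₀−ρ₀) + 1)·T₀^{2(σ₀−ρ₀)}`).
* §3 SELF-DUAL from the box conclusion (a2)_χ: `sqrt_bracket_le_of_box` (letter form, any set `S`), **`norm_le_of_family_selfDual_on`** ∕ `exists_norm_le_of_family_selfDual_on` (★ F2b model:
  `‖ψ z‖ ≤ B·‖φ‖` on `D₁ ∩ {Re ≤ σ₀, |Im| ≥ 1}`), `sqrt_bracket_le_of_truncatedFamily_on` (★ F2's `L²(X)` truncated-family currency).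
* §4 OFF-DUAL bound: **`norm_le_of_family_offDual_on`** (`‖ψ z‖ ≤ T^{2Re z−1}‖φ‖` on all of `D₁`), `normSq_le_rpow_mul_normSq_of_family_offDual_on` (`‖ψ z‖² ≤ T^{4Re z−2}‖φ‖²`).
* §5 OFF-DUAL ⟹ NO POLE (generic, any set `S` surrounding `z₁`: `∀ᶠ z in 𝓝[≠] z₁, z ∈ S`): `eventually_norm_le_of_offDual_bound`, **`analyticAt_of_offDual_bound`** (normal form),
  **`exists_analyticAt_extension_of_offDual_bound`**, **`meromorphicOrderAt_nonneg_of_offDual_bound`**.  The model prints on the pole-exclusion domain `D₁ = (D⁺ ∩ D_n ∩ U) ∖ P` (general-box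
  `_on'` edition of K2E1-p15's `K2E1ChiMaassSelbergContinuedOnBoxesCMTwo`) follow in the companion `K2E1ChiScatteringBoundMaassSelbergOnBoxesU2`.
HONEST LABEL: HC_CM is proved only modulo the 7 printed citations (2 remaining named inputs: hLiu418 = `stmt-HodgeConjecture-24832`, h413 = `stmt-HodgeConjecture-24833`) until rung 0
closes; this file asserts no named fact, is conditional by construction on the relation letters (`hMS` ∕ `hbox` ∕ `hrel` ∕ `h4`), and closes no socket; count-neutral.

## References
* [MoeglinWaldspurger1995] C. Mœglin, J.-L. Waldspurger, *Spectral decomposition and Eisenstein series* (1995), IV.1.9, IV.1.11, IV.2.3, IV.3.12 (a).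
* [Langlands1976] R. P. Langlands, *On the Functional Equations Satisfied by Eisenstein Series*, LNM 544 (1976), §7.
* [Iwaniec2002] H. Iwaniec, *Spectral Methods of Automorphic Forms*, 2nd ed. (2002), §6.3, §7 (p. 103).
* [Arthur1980TraceFormulaII] J. Arthur, *A trace formula for reductive groups II*, Compositio Math. 40 (1980), §4.
-/

set_option autoImplicit false
set_option linter.dupNamespace false  -- the mandated namespace repeats the summit's segment (`HodgeConjecture.HodgeConjecture`)

noncomputable section

open Real Set Filter Topology MeasureTheory Measure NumberField IsDedekindDomain
open scoped ENNReal NNReal ComplexConjugate InnerProductSpace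
open Literature.NumberTheory.Automorphic Literature.NumberTheory.Automorphic.UnitaryGroup AdelicGroupData
open Summit.HodgeConjecture.HodgeConjecture.Cruxes.H413.K2E1BorelEisensteinU
open Summit.HodgeConjecture.HodgeConjecture.Cruxes.H413.K2E1ScatteringBoundMaassSelbergU2 (le_add_sqrt_of_sq_le)
open Summit.HodgeConjecture.HodgeConjecture.Cruxes.H413.K2E1ChiMaassSelbergContinuedCMTwo (poleControl_continued_chi_cm_two_of_truncatedFamily_on)
open Summit.HodgeConjecture.HodgeConjecture.Cruxes.H413.K2E1ChiMaassSelbergContinuedModelsCMTwo (poleControl_continued_chi_cm_two_of_family_selfDual_on normSq_le_of_family_offDual_on)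
open Summit.HodgeConjecture.HodgeConjecture.Cruxes.H413.K2E1BLRemovablePolesU (exists_analyticAt_eventuallyEq_of_differentiableAt_of_eventually_norm_le
  meromorphicAt_and_meromorphicOrderAt_nonneg_of_differentiableAt_of_eventually_norm_le)

namespace Summit.HodgeConjecture.HodgeConjecture.Cruxes.H413.K2E1ChiScatteringBoundMaassSelbergU2

/-! ## §1 Real algebra -/

/-- **(a2)-SHAPE ⟹ `√b ≤ B·√a`**: from `b ≤ (x₂T^{2x₂}√a∕η + √(x₂²T^{4x₂}a∕η² + aT^{4x₂}))²` (the box conclusion (a2) of ★ `poleControl_of_fourTerm` ∕ ★ F2∕F2b), `a, x₂ ≥ 0`, `η, T > 0`: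
`√b ≤ (x₂T^{2x₂}∕η + √(x₂²T^{4x₂}∕η² + T^{4x₂}))·√a` — the right side of (a2) is `√a` times a constant (no sign condition on `a`: both sides vanish for `a < 0`). [folklore] [cite: MoeglinWaldspurger1995, IV.3.12 (a)] -/
theorem sqrt_le_mul_sqrt_of_box {a b T x₂ η : ℝ} (hx₂ : 0 ≤ x₂) (hη : 0 < η) (hT : 0 < T)
    (hbox : b ≤ (x₂ * T ^ (2 * x₂) * Real.sqrt a / η + Real.sqrt (x₂ ^ 2 * T ^ (4 * x₂) * a / η ^ 2 + a * T ^ (4 * x₂))) ^ 2) :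
    Real.sqrt b ≤ (x₂ * T ^ (2 * x₂) / η + Real.sqrt (x₂ ^ 2 * T ^ (4 * x₂) / η ^ 2 + T ^ (4 * x₂))) * Real.sqrt a := by
  have hP : 0 ≤ T ^ (2 * x₂) := Real.rpow_nonneg hT.le _
  have hP4 : 0 ≤ T ^ (4 * x₂) := Real.rpow_nonneg hT.le _
  have hQ : 0 ≤ x₂ ^ 2 * T ^ (4 * x₂) / η ^ 2 + T ^ (4 * x₂) := by positivity
  have hsa : 0 ≤ Real.sqrt a := Real.sqrt_nonneg a
  have hB : 0 ≤ x₂ * T ^ (2 * x₂) / η + Real.sqrt (x₂ ^ 2 * T ^ (4 * x₂) / η ^ 2 + T ^ (4 * x₂)) := by positivity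
  have heq : x₂ * T ^ (2 * x₂) * Real.sqrt a / η + Real.sqrt (x₂ ^ 2 * T ^ (4 * x₂) * a / η ^ 2 + a * T ^ (4 * x₂)) =
      (x₂ * T ^ (2 * x₂) / η + Real.sqrt (x₂ ^ 2 * T ^ (4 * x₂) / η ^ 2 + T ^ (4 * x₂))) * Real.sqrt a := by
    have h1 : x₂ ^ 2 * T ^ (4 * x₂) * a / η ^ 2 + a * T ^ (4 * x₂) = (x₂ ^ 2 * T ^ (4 * x₂) / η ^ 2 + T ^ (4 * x₂)) * a := by ring
    rw [h1, Real.sqrt_mul hQ]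
    ring
  rw [heq] at hbox
  calc Real.sqrt b ≤ Real.sqrt (((x₂ * T ^ (2 * x₂) / η + Real.sqrt (x₂ ^ 2 * T ^ (4 * x₂) / η ^ 2 + T ^ (4 * x₂))) * Real.sqrt a) ^ 2) :=
        Real.sqrt_le_sqrt hbox
    _ = (x₂ * T ^ (2 * x₂) / η + Real.sqrt (x₂ ^ 2 * T ^ (4 * x₂) / η ^ 2 + T ^ (4 * x₂))) * Real.sqrt a := Real.sqrt_sq (mul_nonneg hB hsa)

/-- **`κm‖u‖² ≤ T^{4x}·κm‖φ‖² ⟹ ‖u‖ ≤ T^{2x}·‖φ‖`** (`κ, m, T > 0`; the off-dual bound of ★ F2b unsquared). [folklore] -/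
theorem norm_le_of_normSq_le {V V' : Type*} [NormedAddCommGroup V] [NormedAddCommGroup V'] {κ m T x : ℝ} (hκ : 0 < κ) (hm : 0 < m) (hT : 0 < T) {φ : V} {u : V'}
    (h : κ * m * ‖u‖ ^ 2 ≤ T ^ (4 * x) * (κ * m * ‖φ‖ ^ 2)) : ‖u‖ ≤ T ^ (2 * x) * ‖φ‖ := by
  have hkm : 0 < κ * m := mul_pos hκ hm
  have hP : 0 ≤ T ^ (2 * x) := Real.rpow_nonneg hT.le _
  have h4 : T ^ (4 * x) = T ^ (2 * x) * T ^ (2 * x) := by rw [← Real.rpow_add hT]; congr 1; ring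
  have h1 : ‖u‖ ^ 2 ≤ (T ^ (2 * x) * ‖φ‖) ^ 2 := by
    have h2 : κ * m * ‖u‖ ^ 2 ≤ κ * m * (T ^ (2 * x) * ‖φ‖) ^ 2 := by
      calc κ * m * ‖u‖ ^ 2 ≤ T ^ (4 * x) * (κ * m * ‖φ‖ ^ 2) := h
        _ = κ * m * (T ^ (2 * x) * ‖φ‖) ^ 2 := by rw [h4]; ring
    exact le_of_mul_le_mul_left h2 hkm
  calc ‖u‖ = Real.sqrt (‖u‖ ^ 2) := (Real.sqrt_sq (norm_nonneg _)).symm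
    _ ≤ Real.sqrt ((T ^ (2 * x) * ‖φ‖) ^ 2) := Real.sqrt_le_sqrt h1
    _ = T ^ (2 * x) * ‖φ‖ := Real.sqrt_sq (mul_nonneg hP (norm_nonneg _))

/-! ## §2 SELF-DUAL χ: hypothesis-first on the Maass–Selberg inequality `b ≤ aT^{4x} + 2x√a√bT^{2x}∕|y|` -/

/-- **T1-χ, HYPOTHESIS-FIRST (rank parameter `ρ₀`).**  If the `(χ, τ)` Maass–Selberg inequality `b(z) ≤ a·T₀^{4(σ−ρ₀)} + 2(σ−ρ₀)·√a·√b(z)·T₀^{2(σ−ρ₀)}∕|t|` holds for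
`ρ₀ < σ = Re z ≤ σ₀`, `|t| = |Im z| ≥ 1` (`T₀ ≥ 1`, `a ≥ 0`, `b ≥ 0` — brackets `a = ⟨φ,φ⟩`, `b(z) = ⟨M(z)φ, M(z)φ⟩`), then **`√b(z) ≤ (2(σ₀−ρ₀) + 1)·T₀^{2(σ₀−ρ₀)}·√a`** there:
`s = √b` satisfies `s² ≤ A + B·s` with `A = a·T₀^{4x}`, `B = 2x√aT₀^{2x}` (`1∕|t| ≤ 1`), so `s ≤ B + √A = (2x + 1)T₀^{2x}√a` (★ T1 `le_add_sqrt_of_sq_le`), then monotonicity in `σ`.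
The `(χ,τ)`-twin of ★ `exists_norm_le_of_maassSelberg_ineq`: `‖M(z, χ)φ‖ ≤ B‖φ‖` with `B` free of `φ` and of `y`. [cite: MoeglinWaldspurger1995, IV.2.3, IV.3.12 (a)] [cite: Langlands1976, §7]
[cite: Iwaniec2002, §7 p. 103] -/
theorem sqrt_bracket_le_of_maassSelberg_ineq (ρ₀ σ₀ T₀ : ℝ) (hT₀ : 1 ≤ T₀) {a : ℝ} (ha : 0 ≤ a) {b : ℂ → ℝ} (hb : ∀ z, 0 ≤ b z)
    (hMS : ∀ z : ℂ, ρ₀ < z.re → z.re ≤ σ₀ → 1 ≤ |z.im| →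
      b z ≤ a * T₀ ^ (4 * (z.re - ρ₀)) + 2 * (z.re - ρ₀) * Real.sqrt a * Real.sqrt (b z) * T₀ ^ (2 * (z.re - ρ₀)) / |z.im|)
    {z : ℂ} (hz₁ : ρ₀ < z.re) (hz₂ : z.re ≤ σ₀) (ht : 1 ≤ |z.im|) :
    Real.sqrt (b z) ≤ (2 * (σ₀ - ρ₀) + 1) * T₀ ^ (2 * (σ₀ - ρ₀)) * Real.sqrt a := by
  have hT₀0 : 0 < T₀ := zero_lt_one.trans_le hT₀
  set P : ℝ := T₀ ^ (2 * (z.re - ρ₀)) with hPdef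
  have hP : 0 ≤ P := Real.rpow_nonneg hT₀0.le _
  have hsa : 0 ≤ Real.sqrt a := Real.sqrt_nonneg a
  have hx : 0 ≤ 2 * (z.re - ρ₀) := by linarith
  have h4 : T₀ ^ (4 * (z.re - ρ₀)) = P * P := by rw [hPdef, ← Real.rpow_add hT₀0]; congr 1; ring
  -- `1∕|t| ≤ 1`
  have hdrop : 2 * (z.re - ρ₀) * Real.sqrt a * Real.sqrt (b z) * T₀ ^ (2 * (z.re - ρ₀)) / |z.im| ≤ (2 * (z.re - ρ₀) * Real.sqrt a * P) * Real.sqrt (b z) := by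
    rw [← hPdef]
    calc 2 * (z.re - ρ₀) * Real.sqrt a * Real.sqrt (b z) * P / |z.im| ≤ 2 * (z.re - ρ₀) * Real.sqrt a * Real.sqrt (b z) * P :=
          div_le_self (by positivity) ht
      _ = (2 * (z.re - ρ₀) * Real.sqrt a * P) * Real.sqrt (b z) := by ring
  have hsq : Real.sqrt (b z) ^ 2 ≤ a * (P * P) + (2 * (z.re - ρ₀) * Real.sqrt a * P) * Real.sqrt (b z) := by
    rw [Real.sq_sqrt (hb z), ← h4]
    linarith [hMS z hz₁ hz₂ ht]
  have h1 := le_add_sqrt_of_sq_le (by positivity) (by positivity) hsq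
  have hsq2 : Real.sqrt (a * (P * P)) = Real.sqrt a * P := by rw [Real.sqrt_mul ha, Real.sqrt_mul_self hP]
  rw [hsq2] at h1
  -- monotonicity in `σ`
  have hPP : P ≤ T₀ ^ (2 * (σ₀ - ρ₀)) := Real.rpow_le_rpow_of_exponent_le hT₀ (by linarith)
  calc Real.sqrt (b z) ≤ 2 * (z.re - ρ₀) * Real.sqrt a * P + Real.sqrt a * P := h1
    _ = (2 * (z.re - ρ₀) + 1) * P * Real.sqrt a := by ring
    _ ≤ (2 * (σ₀ - ρ₀) + 1) * T₀ ^ (2 * (σ₀ - ρ₀)) * Real.sqrt a :=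
        mul_le_mul_of_nonneg_right (mul_le_mul (by linarith) hPP hP (by linarith)) hsa

/-! ## §3 SELF-DUAL χ from the box conclusion (a2)_χ of ★ F2 ∕ ★ F2b -/

/-- **`√b ≤ B·√a` ON THE STRIP FROM THE (a2)_χ LETTER** (any set `S`, the VERBATIM shape of conclusion (a2) of ★ `poleControl_continued_chi_cm_two_of_pairing_on` ∕ `…_of_family_on` ∕
`…_of_truncatedFamily_on`): at `z ∈ S` with `½ < Re z ≤ σ₀`, `|Im z| ≥ 1` take `x₁ := Re z − ½`, `x₂ := σ₀ − ½`, `η := 1` and §1.  `B(σ₀, T) = (σ₀ − ½)T^{2(σ₀−½)} +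
√((σ₀ − ½)²T^{4(σ₀−½)} + T^{4(σ₀−½)})` — free of `φ` and of `Im z`. [cite: MoeglinWaldspurger1995, IV.3.12 (a)] [cite: Langlands1976, §7] -/
theorem sqrt_bracket_le_of_box {S : Set ℂ} {T : ℝ} (hT : 1 ≤ T) {a : ℝ} {b : ℂ → ℝ}
    (hbox : ∀ z ∈ S, ∀ {x₁ x₂ η : ℝ}, 0 < x₁ → (z.re - 1 / 2) ∈ Set.Icc x₁ x₂ → 0 < η → η ≤ |z.im| →
      b z ≤ (x₂ * T ^ (2 * x₂) * Real.sqrt a / η + Real.sqrt (x₂ ^ 2 * T ^ (4 * x₂) * a / η ^ 2 + a * T ^ (4 * x₂))) ^ 2)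
    (σ₀ : ℝ) {z : ℂ} (hz : z ∈ S) (hz₁ : 1 / 2 < z.re) (hz₂ : z.re ≤ σ₀) (ht : 1 ≤ |z.im|) :
    Real.sqrt (b z) ≤ ((σ₀ - 1 / 2) * T ^ (2 * (σ₀ - 1 / 2)) + Real.sqrt ((σ₀ - 1 / 2) ^ 2 * T ^ (4 * (σ₀ - 1 / 2)) + T ^ (4 * (σ₀ - 1 / 2)))) * Real.sqrt a := by
  have hT0 : 0 < T := lt_of_lt_of_le one_pos hT
  have hx₂ : 0 ≤ σ₀ - 1 / 2 := by linarith
  have h := @hbox z hz (z.re - 1 / 2) (σ₀ - 1 / 2) 1 (by linarith) ⟨le_rfl, by linarith⟩ one_pos ht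
  have h2 := sqrt_le_mul_sqrt_of_box hx₂ one_pos hT0 h
  simpa only [div_one, one_pow] using h2

section Model

variable {V : Type*} [NormedAddCommGroup V] [InnerProductSpace ℂ V] {H : Type*} [NormedAddCommGroup H] [InnerProductSpace ℂ H]

/-- **T1-χ, SELF-DUAL MODEL (`χ = χʷ`): `‖M(z, χ)φ‖ ≤ B(σ₀, T)·‖φ‖` ON `D₁ ∩ {Re z ≤ σ₀, |Im z| ≥ 1}`** — ★ F2b `poleControl_continued_chi_cm_two_of_family_selfDual_on` (its letters VERBATIM:
`D₁ ⊆ D⁺` open preconnected ⊇ the sub-tube boxes, `T ≥ 1`, `cμ, K, κ, m > 0`, `φ ≠ 0`, the continued section `ψ = M(·, χ)φ` holomorphic on `D₁`, `F : ℂ → H` holomorphic on `D₁` with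
the four-bracket relation on the sub-tube) read through `sqrt_bracket_le_of_box`; `B(σ₀, T) = (σ₀ − ½)T^{2(σ₀−½)} + √((σ₀ − ½)²T^{4(σ₀−½)} + T^{4(σ₀−½)})` is FREE OF `φ` AND OF `Im z`.
[cite: MoeglinWaldspurger1995, IV.2.3, IV.3.12 (a)] [cite: Arthur1980TraceFormulaII, §4] [cite: Langlands1976, §7] -/
theorem norm_le_of_family_selfDual_on {D₁ : Set ℂ} (hD₁ : IsOpen D₁) (hD₁c : IsPreconnected D₁) (hD₁sub : D₁ ⊆ {z : ℂ | 1 / 2 < z.re ∧ 0 < z.im})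
    (hbox₁ : {z : ℂ | (3 < z.re ∧ z.re < 4) ∧ 0 < z.im} ⊆ D₁) (hbox₂ : {z : ℂ | (1 < z.re ∧ z.re < 2) ∧ 0 < z.im} ⊆ D₁)
    {T cμ K κ m : ℝ} (hT : 1 ≤ T) (hcμ : 0 < cμ) (hK : 0 < K) (hκ : 0 < κ) (hm : 0 < m) {φ : V} (hφ : φ ≠ 0) {ψ : ℂ → V} (hψ : DifferentiableOn ℂ ψ D₁)
    (F : ℂ → H) (hFd : DifferentiableOn ℂ F D₁)
    (hrel : ∀ z ∈ D₁, ∀ z' ∈ D₁, 1 < z'.re → z'.re < z.re →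
      ⟪F z', F z⟫_ℂ = ((cμ : ℝ) : ℂ) * (((K : ℝ) : ℂ) *
        ((((T : ℝ) : ℂ) ^ (z + conj z' - 1) / (z + conj z' - 1)) * (((κ : ℝ) : ℂ) * (((m : ℝ) : ℂ) * ⟪φ, φ⟫_ℂ))
          + (((T : ℝ) : ℂ) ^ (z - conj z') / (z - conj z')) * (((κ : ℝ) : ℂ) * (((m : ℝ) : ℂ) * ⟪ψ z', φ⟫_ℂ))
          - (((T : ℝ) : ℂ) ^ (-(z - conj z')) / (z - conj z')) * (((κ : ℝ) : ℂ) * (((m : ℝ) : ℂ) * ⟪φ, ψ z⟫_ℂ))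
          - (((T : ℝ) : ℂ) ^ (-(z + conj z' - 1)) / (z + conj z' - 1)) * (((κ : ℝ) : ℂ) * (((m : ℝ) : ℂ) * ⟪ψ z', ψ z⟫_ℂ)))))
    (σ₀ : ℝ) {z : ℂ} (hz : z ∈ D₁) (hz₂ : z.re ≤ σ₀) (ht : 1 ≤ |z.im|) :
    ‖ψ z‖ ≤ ((σ₀ - 1 / 2) * T ^ (2 * (σ₀ - 1 / 2)) + Real.sqrt ((σ₀ - 1 / 2) ^ 2 * T ^ (4 * (σ₀ - 1 / 2)) + T ^ (4 * (σ₀ - 1 / 2)))) * ‖φ‖ := by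
  obtain ⟨-, h2, -⟩ := poleControl_continued_chi_cm_two_of_family_selfDual_on hD₁ hD₁c hD₁sub hbox₁ hbox₂ hT hcμ hK hκ hm hφ hψ F hFd hrel hz
  have hz₁ : 1 / 2 < z.re := (hD₁sub hz).1
  have hT0 : 0 < T := lt_of_lt_of_le one_pos hT
  have hx₂ : 0 ≤ σ₀ - 1 / 2 := by linarith
  have hkm : 0 < κ * m := mul_pos hκ hm
  have h := @h2 (z.re - 1 / 2) (σ₀ - 1 / 2) 1 (by linarith) ⟨le_rfl, by linarith⟩ one_pos ht
  have h3 := sqrt_le_mul_sqrt_of_box (a := κ * m * ‖φ‖ ^ 2) hx₂ one_pos hT0 h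
  simp only [div_one, one_pow] at h3
  have e1 : Real.sqrt (κ * m * ‖ψ z‖ ^ 2) = Real.sqrt (κ * m) * ‖ψ z‖ := by rw [Real.sqrt_mul hkm.le, Real.sqrt_sq (norm_nonneg _)]
  have e2 : Real.sqrt (κ * m * ‖φ‖ ^ 2) = Real.sqrt (κ * m) * ‖φ‖ := by rw [Real.sqrt_mul hkm.le, Real.sqrt_sq (norm_nonneg _)]
  rw [e1, e2] at h3
  have h4 : Real.sqrt (κ * m) * ‖ψ z‖ ≤ Real.sqrt (κ * m) *
      (((σ₀ - 1 / 2) * T ^ (2 * (σ₀ - 1 / 2)) + Real.sqrt ((σ₀ - 1 / 2) ^ 2 * T ^ (4 * (σ₀ - 1 / 2)) + T ^ (4 * (σ₀ - 1 / 2)))) * ‖φ‖) := by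
    calc Real.sqrt (κ * m) * ‖ψ z‖ ≤ _ := h3
      _ = _ := by ring
  exact le_of_mul_le_mul_left h4 (Real.sqrt_pos.2 hkm)

/-- **T1-χ, SELF-DUAL MODEL, `∃ B` FORM**: `∃ B ≥ 0, ∀ z ∈ D₁, Re z ≤ σ₀ → |Im z| ≥ 1 → ‖ψ z‖ ≤ B·‖φ‖` — the dealer's (141)(i) bytes «`‖M z φ‖ ≤ B‖φ‖` on `½ < re z ≤ σ₀`, `1 ≤ |im z|`» on
the part of the strip the pole-exclusion domain `D₁` reaches. [cite: MoeglinWaldspurger1995, IV.3.12 (a)] [cite: Langlands1976, §7] -/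
theorem exists_norm_le_of_family_selfDual_on {D₁ : Set ℂ} (hD₁ : IsOpen D₁) (hD₁c : IsPreconnected D₁) (hD₁sub : D₁ ⊆ {z : ℂ | 1 / 2 < z.re ∧ 0 < z.im})
    (hbox₁ : {z : ℂ | (3 < z.re ∧ z.re < 4) ∧ 0 < z.im} ⊆ D₁) (hbox₂ : {z : ℂ | (1 < z.re ∧ z.re < 2) ∧ 0 < z.im} ⊆ D₁)
    {T cμ K κ m : ℝ} (hT : 1 ≤ T) (hcμ : 0 < cμ) (hK : 0 < K) (hκ : 0 < κ) (hm : 0 < m) {φ : V} (hφ : φ ≠ 0) {ψ : ℂ → V} (hψ : DifferentiableOn ℂ ψ D₁)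
    (F : ℂ → H) (hFd : DifferentiableOn ℂ F D₁)
    (hrel : ∀ z ∈ D₁, ∀ z' ∈ D₁, 1 < z'.re → z'.re < z.re →
      ⟪F z', F z⟫_ℂ = ((cμ : ℝ) : ℂ) * (((K : ℝ) : ℂ) *
        ((((T : ℝ) : ℂ) ^ (z + conj z' - 1) / (z + conj z' - 1)) * (((κ : ℝ) : ℂ) * (((m : ℝ) : ℂ) * ⟪φ, φ⟫_ℂ))
          + (((T : ℝ) : ℂ) ^ (z - conj z') / (z - conj z')) * (((κ : ℝ) : ℂ) * (((m : ℝ) : ℂ) * ⟪ψ z', φ⟫_ℂ))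
          - (((T : ℝ) : ℂ) ^ (-(z - conj z')) / (z - conj z')) * (((κ : ℝ) : ℂ) * (((m : ℝ) : ℂ) * ⟪φ, ψ z⟫_ℂ))
          - (((T : ℝ) : ℂ) ^ (-(z + conj z' - 1)) / (z + conj z' - 1)) * (((κ : ℝ) : ℂ) * (((m : ℝ) : ℂ) * ⟪ψ z', ψ z⟫_ℂ)))))
    (σ₀ : ℝ) :
    ∃ B : ℝ, 0 ≤ B ∧ ∀ z ∈ D₁, z.re ≤ σ₀ → 1 ≤ |z.im| → ‖ψ z‖ ≤ B * ‖φ‖ := by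
  refine ⟨|(σ₀ - 1 / 2) * T ^ (2 * (σ₀ - 1 / 2)) + Real.sqrt ((σ₀ - 1 / 2) ^ 2 * T ^ (4 * (σ₀ - 1 / 2)) + T ^ (4 * (σ₀ - 1 / 2)))|, abs_nonneg _,
    fun z hz hz₂ ht => (norm_le_of_family_selfDual_on hD₁ hD₁c hD₁sub hbox₁ hbox₂ hT hcμ hK hκ hm hφ hψ F hFd hrel σ₀ hz hz₂ ht).trans ?_⟩
  exact mul_le_mul_of_nonneg_right (le_abs_self _) (norm_nonneg _)

end Model

section TruncatedFamily

variable (L : Type) [Field L] [NumberField L] [IsCMField L]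
variable [MeasurableSpace (quasiSplit (↥(maximalRealSubfield L)) L (IsCMField.complexConj L) 2).Adelic]

/-- **T1-χ IN THE `L²(X, μ)` TRUNCATED-FAMILY CURRENCY** (the letters of ★ F2 `poleControl_continued_chi_cm_two_of_truncatedFamily_on` VERBATIM — bracket letters `a`, `b`, `B₁…B₄` with
Cauchy–Schwarz, the holomorphic truncated family `F : ℂ → L²(X, μ)` on `D₁` agreeing with `[Λ^T E(φ, z)]` on the tube, and FILE 1's relation `h4` on the sub-tube): on `D₁ ∩
{Re z ≤ σ₀, |Im z| ≥ 1}`, `√b(z) ≤ B(σ₀, T)·√a`. [cite: MoeglinWaldspurger1995, IV.2.3, IV.3.12 (a)] [cite: Arthur1980TraceFormulaII, §4] [cite: Langlands1976, §7] -/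
theorem sqrt_bracket_le_of_truncatedFamily_on {D₁ : Set ℂ} (hD₁ : IsOpen D₁) (hD₁c : IsPreconnected D₁) (hD₁sub : D₁ ⊆ {z : ℂ | 1 / 2 < z.re ∧ 0 < z.im})
    (hbox₁ : {z : ℂ | (3 < z.re ∧ z.re < 4) ∧ 0 < z.im} ⊆ D₁) (hbox₂ : {z : ℂ | (1 < z.re ∧ z.re < 2) ∧ 0 < z.im} ⊆ D₁)
    (μ : Measure (quasiSplit (↥(maximalRealSubfield L)) L (IsCMField.complexConj L) 2).automorphicQuotient)
    (ν : Measure ↥(adelicUnipotent (↥(maximalRealSubfield L)) L (IsCMField.complexConj L) 2)) (𝓕 : Set ↥(adelicUnipotent (↥(maximalRealSubfield L)) L (IsCMField.complexConj L) 2))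
    {T : ℝ≥0} (hT : 1 ≤ T) {cμ K : ℝ} (hcμ : 0 < cμ) (hK : 0 < K) {a : ℝ} (ha : 0 < a) {b : ℂ → ℝ} (hb : ∀ z ∈ D₁, 0 ≤ b z)
    {B₁ : ℂ} {B₂ B₃ : ℂ → ℂ} {B₄ : ℂ → ℂ → ℂ} (hB₁ : B₁ = ((a : ℝ) : ℂ)) (hB₂ : DifferentiableOn ℂ (fun w : ℂ => B₂ (conj w)) {w : ℂ | conj w ∈ D₁}) (hB₃ : DifferentiableOn ℂ B₃ D₁)
    (hB₃₂ : ∀ z ∈ D₁, B₃ z = conj (B₂ z)) (hB₄₁ : ∀ z' ∈ D₁, DifferentiableOn ℂ (fun z : ℂ => B₄ z z') D₁)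
    (hB₄₂ : ∀ z ∈ D₁, DifferentiableOn ℂ (fun w : ℂ => B₄ z (conj w)) {w : ℂ | conj w ∈ D₁}) (hB₄d : ∀ z ∈ D₁, B₄ z z = ((b z : ℝ) : ℂ))
    (hCS : ∀ z ∈ D₁, ‖B₂ z‖ ^ 2 ≤ a * b z)
    (φ : (quasiSplit (↥(maximalRealSubfield L)) L (IsCMField.complexConj L) 2).Adelic → ℂ)
    (F : ℂ → Lp ℂ 2 μ) (hFd : DifferentiableOn ℂ F D₁)
    (hFtube : ∀ z ∈ D₁, 1 < z.re → ((F z : Lp ℂ 2 μ) : (quasiSplit (↥(maximalRealSubfield L)) L (IsCMField.complexConj L) 2).automorphicQuotient → ℂ) =ᵐ[μ] (quasiSplit (↥(maximalRealSubfield L)) L (IsCMField.complexConj L) 2).quotFun (truncation ν 𝓕 T (eisensteinSeriesU (flatSectionU φ z))))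
    (h4 : ∀ z z' : ℂ, 1 < z'.re → z'.re < z.re →
      ∫ x, (quasiSplit (↥(maximalRealSubfield L)) L (IsCMField.complexConj L) 2).quotFun (truncation ν 𝓕 T (eisensteinSeriesU (flatSectionU φ z))) x * conj ((quasiSplit (↥(maximalRealSubfield L)) L (IsCMField.complexConj L) 2).quotFun (truncation ν 𝓕 T (eisensteinSeriesU (flatSectionU φ z'))) x) ∂μ =
      ((cμ : ℝ) : ℂ) * (((K : ℝ) : ℂ) *
        ((((T : ℝ) : ℂ) ^ (z + conj z' - 1) / (z + conj z' - 1)) * B₁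
          + (((T : ℝ) : ℂ) ^ (z - conj z') / (z - conj z')) * B₂ z'
          - (((T : ℝ) : ℂ) ^ (-(z - conj z')) / (z - conj z')) * B₃ z
          - (((T : ℝ) : ℂ) ^ (-(z + conj z' - 1)) / (z + conj z' - 1)) * B₄ z z')))
    (σ₀ : ℝ) {z : ℂ} (hz : z ∈ D₁) (hz₂ : z.re ≤ σ₀) (ht : 1 ≤ |z.im|) :
    Real.sqrt (b z) ≤ ((σ₀ - 1 / 2) * (T : ℝ) ^ (2 * (σ₀ - 1 / 2)) + Real.sqrt ((σ₀ - 1 / 2) ^ 2 * (T : ℝ) ^ (4 * (σ₀ - 1 / 2)) + (T : ℝ) ^ (4 * (σ₀ - 1 / 2)))) * Real.sqrt a := by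
  obtain ⟨-, h2, -⟩ := poleControl_continued_chi_cm_two_of_truncatedFamily_on L hD₁ hD₁c hD₁sub hbox₁ hbox₂ μ ν 𝓕 hT hcμ hK ha hb hB₁ hB₂ hB₃ hB₃₂ hB₄₁ hB₄₂ hB₄d hCS φ F hFd hFtube h4 hz
  have hz₁ : 1 / 2 < z.re := (hD₁sub hz).1
  have hT0 : 0 < (T : ℝ) := lt_of_lt_of_le one_pos (by exact_mod_cast hT)
  have hx₂ : 0 ≤ σ₀ - 1 / 2 := by linarith
  have h := @h2 (z.re - 1 / 2) (σ₀ - 1 / 2) 1 (by linarith) ⟨le_rfl, by linarith⟩ one_pos ht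
  have h3 := sqrt_le_mul_sqrt_of_box hx₂ one_pos hT0 h
  simpa only [div_one, one_pow] using h3

end TruncatedFamily

/-! ## §4 OFF-DUAL χ: the `y`-free bound `‖M(z, χ)φ‖ ≤ T^{2Re z − 1}·‖φ‖` on all of `D₁` -/

section OffDual

variable {V : Type*} [NormedAddCommGroup V] [InnerProductSpace ℂ V] {V' : Type*} [NormedAddCommGroup V'] [InnerProductSpace ℂ V']
  {H : Type*} [NormedAddCommGroup H] [InnerProductSpace ℂ H]

/-- **T1-χ, OFF-DUAL MODEL (`χ ≠ χʷ`): `‖M(z, χ)φ‖ ≤ T^{2Re z − 1}·‖φ‖` AT EVERY `z ∈ D₁`** — no `1∕|Im z|`, valid up to the real axis (★ F2b `normSq_le_of_family_offDual_on` unsquared; its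
letters VERBATIM plus `κ, m > 0`). [cite: MoeglinWaldspurger1995, IV.1.11, IV.3.12 (a)] [cite: Arthur1980TraceFormulaII, §4] -/
theorem norm_le_of_family_offDual_on {D₁ : Set ℂ} (hD₁ : IsOpen D₁) (hD₁c : IsPreconnected D₁) (hD₁sub : D₁ ⊆ {z : ℂ | 1 / 2 < z.re ∧ 0 < z.im})
    (hbox₁ : {z : ℂ | (3 < z.re ∧ z.re < 4) ∧ 0 < z.im} ⊆ D₁) (hbox₂ : {z : ℂ | (1 < z.re ∧ z.re < 2) ∧ 0 < z.im} ⊆ D₁)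
    {T cμ K κ m : ℝ} (hT : 1 ≤ T) (hcμ : 0 < cμ) (hK : 0 < K) (hκ : 0 < κ) (hm : 0 < m) (φ : V) {ψ : ℂ → V'} (hψ : DifferentiableOn ℂ ψ D₁)
    (F : ℂ → H) (hFd : DifferentiableOn ℂ F D₁)
    (hrel : ∀ z ∈ D₁, ∀ z' ∈ D₁, 1 < z'.re → z'.re < z.re →
      ⟪F z', F z⟫_ℂ = ((cμ : ℝ) : ℂ) * (((K : ℝ) : ℂ) *
        ((((T : ℝ) : ℂ) ^ (z + conj z' - 1) / (z + conj z' - 1)) * (((κ : ℝ) : ℂ) * (((m : ℝ) : ℂ) * ⟪φ, φ⟫_ℂ))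
          - (((T : ℝ) : ℂ) ^ (-(z + conj z' - 1)) / (z + conj z' - 1)) * (((κ : ℝ) : ℂ) * (((m : ℝ) : ℂ) * ⟪ψ z', ψ z⟫_ℂ)))))
    {z : ℂ} (hz : z ∈ D₁) :
    ‖ψ z‖ ≤ T ^ (2 * z.re - 1) * ‖φ‖ := by
  have h := normSq_le_of_family_offDual_on hD₁ hD₁c hD₁sub hbox₁ hbox₂ hT hcμ hK κ m φ hψ F hFd hrel hz
  have h2 := norm_le_of_normSq_le hκ hm (lt_of_lt_of_le one_pos hT) h
  have e : 2 * (z.re - 1 / 2) = 2 * z.re - 1 := by ring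
  rwa [e] at h2

/-- **OFF-DUAL, SQUARED FORM**: `‖M(z, χ)φ‖² ≤ T^{4Re z − 2}·‖φ‖²` at every `z ∈ D₁` (the dealer's (141)(ii) bytes). [cite: MoeglinWaldspurger1995, IV.1.11, IV.3.12 (a)] -/
theorem normSq_le_rpow_mul_normSq_of_family_offDual_on {D₁ : Set ℂ} (hD₁ : IsOpen D₁) (hD₁c : IsPreconnected D₁) (hD₁sub : D₁ ⊆ {z : ℂ | 1 / 2 < z.re ∧ 0 < z.im})
    (hbox₁ : {z : ℂ | (3 < z.re ∧ z.re < 4) ∧ 0 < z.im} ⊆ D₁) (hbox₂ : {z : ℂ | (1 < z.re ∧ z.re < 2) ∧ 0 < z.im} ⊆ D₁)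
    {T cμ K κ m : ℝ} (hT : 1 ≤ T) (hcμ : 0 < cμ) (hK : 0 < K) (hκ : 0 < κ) (hm : 0 < m) (φ : V) {ψ : ℂ → V'} (hψ : DifferentiableOn ℂ ψ D₁)
    (F : ℂ → H) (hFd : DifferentiableOn ℂ F D₁)
    (hrel : ∀ z ∈ D₁, ∀ z' ∈ D₁, 1 < z'.re → z'.re < z.re →
      ⟪F z', F z⟫_ℂ = ((cμ : ℝ) : ℂ) * (((K : ℝ) : ℂ) *
        ((((T : ℝ) : ℂ) ^ (z + conj z' - 1) / (z + conj z' - 1)) * (((κ : ℝ) : ℂ) * (((m : ℝ) : ℂ) * ⟪φ, φ⟫_ℂ))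
          - (((T : ℝ) : ℂ) ^ (-(z + conj z' - 1)) / (z + conj z' - 1)) * (((κ : ℝ) : ℂ) * (((m : ℝ) : ℂ) * ⟪ψ z', ψ z⟫_ℂ)))))
    {z : ℂ} (hz : z ∈ D₁) :
    ‖ψ z‖ ^ 2 ≤ T ^ (4 * z.re - 2) * ‖φ‖ ^ 2 := by
  have hT0 : 0 < T := lt_of_lt_of_le one_pos hT
  have h := norm_le_of_family_offDual_on hD₁ hD₁c hD₁sub hbox₁ hbox₂ hT hcμ hK hκ hm φ hψ F hFd hrel hz
  have hP : 0 ≤ T ^ (2 * z.re - 1) := Real.rpow_nonneg hT0.le _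
  have h4 : T ^ (4 * z.re - 2) = T ^ (2 * z.re - 1) * T ^ (2 * z.re - 1) := by rw [← Real.rpow_add hT0]; congr 1; ring
  calc ‖ψ z‖ ^ 2 ≤ (T ^ (2 * z.re - 1) * ‖φ‖) ^ 2 := pow_le_pow_left₀ (norm_nonneg _) h 2
    _ = T ^ (4 * z.re - 2) * ‖φ‖ ^ 2 := by rw [h4]; ring

end OffDual

/-! ## §5 OFF-DUAL ⟹ NO POLE: a `y`-free bound of shape `T^{2Re z−1}·C` on a set surrounding `z₁` makes `z₁` a removable singularity -/

section NoPole

variable {X : Type*} [NormedAddCommGroup X] [NormedSpace ℂ X]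

omit [NormedSpace ℂ X] in
/-- **A `y`-FREE BOUND IS A LOCAL BOUND**: if `‖ψ z‖ ≤ T^{2Re z − 1}·C` on a set `S` with `∀ᶠ z in 𝓝[≠] z₁, z ∈ S` (`T ≥ 1`, `C ≥ 0`), then `ψ` is bounded on a punctured neighbourhood of `z₁`
(by `T^{2(Re z₁ + 1) − 1}·C`, as `Re z < Re z₁ + 1` near `z₁`). [folklore] -/
theorem eventually_norm_le_of_offDual_bound {ψ : ℂ → X} {S : Set ℂ} {z₁ : ℂ} (hev : ∀ᶠ z in 𝓝[≠] z₁, z ∈ S) {T : ℝ} (hT : 1 ≤ T) {C : ℝ} (hC : 0 ≤ C)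
    (hbd : ∀ z ∈ S, ‖ψ z‖ ≤ T ^ (2 * z.re - 1) * C) : ∃ M : ℝ, ∀ᶠ z in 𝓝[≠] z₁, ‖ψ z‖ ≤ M := by
  refine ⟨T ^ (2 * (z₁.re + 1) - 1) * C, ?_⟩
  have hre : ∀ᶠ z in 𝓝 z₁, z.re < z₁.re + 1 :=
    (Complex.continuous_re.tendsto z₁).eventually (eventually_lt_nhds (by linarith))
  filter_upwards [hev, mem_nhdsWithin_of_mem_nhds hre] with z hz hz'
  exact (hbd z hz).trans (mul_le_mul_of_nonneg_right (Real.rpow_le_rpow_of_exponent_le hT (by linarith)) hC)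

/-- **OFF-DUAL ⟹ NO POLE (normal form).**  A function meromorphic in normal form at `z₁` (e.g. the continued `z ↦ M(z, χ)φ` glued in normal form) that obeys a `y`-free bound
`‖ψ z‖ ≤ T^{2Re z − 1}·C` on a set surrounding `z₁` is ANALYTIC at `z₁` — Riemann, ★ (L4) `MeromorphicNFAt.analyticAt_of_eventually_norm_le`. [cite: MoeglinWaldspurger1995, IV.1.9, IV.1.11] -/
theorem analyticAt_of_offDual_bound {ψ : ℂ → X} {S : Set ℂ} {z₁ : ℂ} (hev : ∀ᶠ z in 𝓝[≠] z₁, z ∈ S) {T : ℝ} (hT : 1 ≤ T) {C : ℝ} (hC : 0 ≤ C)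
    (hbd : ∀ z ∈ S, ‖ψ z‖ ≤ T ^ (2 * z.re - 1) * C) (hψ : MeromorphicNFAt ψ z₁) : AnalyticAt ℂ ψ z₁ :=
  hψ.analyticAt_of_eventually_norm_le (eventually_norm_le_of_offDual_bound hev hT hC hbd)

variable [CompleteSpace X]

/-- **OFF-DUAL ⟹ NO POLE (holomorphic-off-`P` form).**  If `ψ` is complex-differentiable at every point of a punctured neighbourhood of `z₁` and obeys a `y`-free bound
`‖ψ z‖ ≤ T^{2Re z − 1}·C` on a set surrounding `z₁`, then `ψ` has an ANALYTIC continuation across `z₁`: `∃ G, AnalyticAt ℂ G z₁ ∧ G = ψ` on `𝓝[≠] z₁` (★ (L4) Banach-valued Riemann).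
[cite: MoeglinWaldspurger1995, IV.1.9, IV.1.11] [cite: BernsteinLapid2019, §4 p. 10] -/
theorem exists_analyticAt_extension_of_offDual_bound {ψ : ℂ → X} {S : Set ℂ} {z₁ : ℂ} (hev : ∀ᶠ z in 𝓝[≠] z₁, z ∈ S) {T : ℝ} (hT : 1 ≤ T) {C : ℝ} (hC : 0 ≤ C)
    (hbd : ∀ z ∈ S, ‖ψ z‖ ≤ T ^ (2 * z.re - 1) * C) (hd : ∀ᶠ z in 𝓝[≠] z₁, DifferentiableAt ℂ ψ z) :
    ∃ G : ℂ → X, AnalyticAt ℂ G z₁ ∧ G =ᶠ[𝓝[≠] z₁] ψ :=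
  exists_analyticAt_eventuallyEq_of_differentiableAt_of_eventually_norm_le hd (eventually_norm_le_of_offDual_bound hev hT hC hbd)

/-- **OFF-DUAL ⟹ NON-NEGATIVE ORDER**: under the same hypotheses `ψ` is `MeromorphicAt z₁` with `0 ≤ ord_{z₁} ψ` — NO POLE at `z₁`. [cite: MoeglinWaldspurger1995, IV.1.9, IV.1.11] -/
theorem meromorphicOrderAt_nonneg_of_offDual_bound {ψ : ℂ → X} {S : Set ℂ} {z₁ : ℂ} (hev : ∀ᶠ z in 𝓝[≠] z₁, z ∈ S) {T : ℝ} (hT : 1 ≤ T) {C : ℝ} (hC : 0 ≤ C)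
    (hbd : ∀ z ∈ S, ‖ψ z‖ ≤ T ^ (2 * z.re - 1) * C) (hd : ∀ᶠ z in 𝓝[≠] z₁, DifferentiableAt ℂ ψ z) :
    MeromorphicAt ψ z₁ ∧ 0 ≤ meromorphicOrderAt ψ z₁ :=
  meromorphicAt_and_meromorphicOrderAt_nonneg_of_differentiableAt_of_eventually_norm_le hd (eventually_norm_le_of_offDual_bound hev hT hC hbd)

end NoPole

end Summit.HodgeConjecture.HodgeConjecture.Cruxes.H413.K2E1ChiScatteringBoundMaassSelbergU2

end
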